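import Literature.NumberTheory.LFunctions.AriasDeReynaExpansion
import Mathlib.MeasureTheory.Integral.Gamma
import Mathlib.MeasureTheory.Measure.Lebesgue.Integral
import Mathlib.Analysis.SpecialFunctions.Log.Deriv
import Mathlib.Analysis.Real.Pi.Bounds
import HarnessLib

/-!
# Arias de Reyna's bound for the Riemann–Siegel coefficients (Math. Comp. 80 (2011), Thm. 4.1)

Topic `Literature/NumberTheory/LFunctions` (namespace `Literature.NumberTheory.LFunctions.AriasDeReyna`).
Fourth file of the proof of the tree's named fact `Literature.NumberTheory.LFunctions.arias_lehmer_rs_bound`.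
For the coefficients `C_k` (`k ≥ 1`) of Lehmer's form of the Riemann–Siegel expansion
(`Literature.NumberTheory.LFunctions.AriasDeReyna.coefC`, `AriasDeReynaExpansion.lean`) we prove

  `|C_k| ≤ c(σ) Γ(k/2) / b(σ)^k`,  `c(σ) = 9^σ/(√2π)`, `b(σ) = 2` (`σ > 0`),
  `c(σ) = 2^{−σ}/(√2π)`, `b(σ) = √((3 − 2 log 2)π)` (`σ ≤ 0`)  (Thm. 4.1, eqs. (4.1)–(4.3)),

for EVERY real `a` (also at the integers, where the source modifies the path). The proof follows the
source: the Cauchy estimate on the circle `|ζ| = r` (`norm_qCoeff_le`, `AriasDeReynaKernel.lean`),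
`|x/cosh| ≤ …` in the form `|u/sin π(a + u(1+i))| ≤ 1/π` (`norm_coefIntegrand_le`), the Gaussian moment
`∫ |u|^{k−1} e^{−cu²} du = c^{−k/2} Γ(k/2)` (`integral_abs_pow_mul_exp`), then `r → 1` for `σ ≤ 0`
(`norm_coefC_le_of_nonpos`) and `r = 8/9` with the numerical inequality
`(64/81)(13/8 − (81/64) log(17/9)) · 2π ≥ 4`, i.e. `log(17/9) ≤ 0.6473` (`norm_coefC_le_of_pos`).

Everything is proved; no named facts.

## References

* J. Arias de Reyna, *High precision computation of Riemann's zeta function by the Riemann–Siegel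
  formula, I*, Math. Comp. 80 (2011), 995–1009: Thm. 4.1, eqs. (4.1)–(4.6). [AriasDeReyna2011]
-/

noncomputable section

open Complex MeasureTheory Set Filter Metric Real
open scoped Topology
open Literature.NumberTheory.LFunctions.SiegelIntegral Literature.NumberTheory.LFunctions.Gabcke

namespace Literature.NumberTheory.LFunctions

namespace AriasDeReyna

/-! ## The Gaussian moment -/

/-- `∫_ℝ |u|^{k−1} e^{−cu²} du = c^{−k/2} Γ(k/2)` (`k ≥ 1`, `c > 0`). [cite: AriasDeReyna2011, eq. (4.6)] -/
theorem integral_abs_pow_mul_exp {k : ℕ} (hk : 1 ≤ k) {c : ℝ} (hc : 0 < c) :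
    ∫ u : ℝ, |u| ^ (k - 1) * Real.exp (-c * u ^ 2) = c ^ (-((k : ℝ) / 2)) * Real.Gamma ((k : ℝ) / 2) := by
  have h := integral_comp_abs (f := fun x : ℝ ↦ x ^ (k - 1) * Real.exp (-c * x ^ 2))
  have heq : (fun u : ℝ ↦ |u| ^ (k - 1) * Real.exp (-c * u ^ 2)) = fun u : ℝ ↦ |u| ^ (k - 1) * Real.exp (-c * |u| ^ 2) := by
    funext u; rw [sq_abs]
  rw [heq, h]
  have h2 := _root_.integral_rpow_mul_exp_neg_mul_rpow (p := 2) (q := (k : ℝ) - 1) (b := c) (by norm_num)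
    (by have : (1:ℝ) ≤ k := by exact_mod_cast hk
        linarith) hc
  have h3 : ∫ x in Ioi (0:ℝ), x ^ (k - 1) * Real.exp (-c * x ^ 2) = ∫ x in Ioi (0:ℝ), x ^ ((k : ℝ) - 1) * Real.exp (-c * x ^ (2:ℝ)) := by
    refine setIntegral_congr_fun measurableSet_Ioi fun x hx ↦ ?_
    have hx0 : 0 ≤ x := le_of_lt hx
    rw [← Real.rpow_natCast x (k - 1), Nat.cast_sub hk, Nat.cast_one, ← Real.rpow_natCast x 2]
    norm_num
  rw [h3, h2]
  have hk1 : ((k : ℝ) - 1 + 1) = k := by ring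
  rw [hk1, neg_div]
  ring

/-- Integrability of `|u|^{k−1} e^{−cu²}` (`c > 0`). [cite: AriasDeReyna2011, eq. (4.6)] -/
lemma integrable_abs_pow_mul_exp (k : ℕ) {c : ℝ} (hc : 0 < c) :
    Integrable fun u : ℝ ↦ |u| ^ k * Real.exp (-c * u ^ 2) := by
  have h := integrable_rpow_mul_exp_neg_mul_sq hc (s := k) (by have := Nat.cast_nonneg (α := ℝ) k; linarith)
  refine h.norm.congr (Eventually.of_forall fun u ↦ ?_)
  simp only [Real.norm_eq_abs, abs_mul, abs_of_pos (Real.exp_pos _), Real.rpow_natCast, abs_pow]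

/-! ## The bound at radius `r` -/

/-- `m_r = 1 + V(−r) ≥ 1/2` for every `r > 0` (`log(1+r) ≤ r`). [cite: AriasDeReyna2011, proof of Thm. 4.1] -/
lemma half_le_one_add_re_fKer_neg {r : ℝ} (hr0 : 0 < r) : 1 / 2 ≤ 1 + (fKer (-r)).re := by
  rw [fKer_neg_real hr0, Complex.ofReal_re]
  have h := Real.log_le_sub_one_of_pos (by linarith : (0:ℝ) < 1 + r)
  have h1 : Real.log (1 + r) / r ^ 2 ≤ 1 / r := by
    rw [div_le_div_iff₀ (by positivity) hr0]
    nlinarith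
  rw [neg_div]
  linarith

/-- `‖c‖ = √2` for the constant `c = e^{−iπ/8}(−(1+i))`. [cite: AriasDeReyna2011, eq. (3.3)] -/
lemma norm_cConst : ‖cConst‖ = Real.sqrt 2 := by
  rw [cConst, norm_mul, norm_neg, Complex.norm_exp]
  have h1 : (-(π * I / 8) : ℂ).re = 0 := by simp
  rw [h1, Real.exp_zero, one_mul]
  have : (1 : ℂ) + I = ((1 : ℝ) : ℂ) + ((1 : ℝ) : ℂ) * I := by simp
  rw [this, Complex.norm_add_mul_I]
  norm_num

/-- **The bound at radius `r`** (proof of Thm. 4.1 before the choice of `r`): for `k ≥ 1`, `0 < r < 1`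
and every real `a`,
`|C_k| ≤ (A_σ(r)/(√2 π)) Γ(k/2) / (r √(2π(1 + V(−r))))^k`. [cite: AriasDeReyna2011, proof of Thm. 4.1 ("various upper estimates of the same type")] -/
theorem norm_coefC_le_of_radius (σ a : ℝ) {k : ℕ} (hk : 1 ≤ k) {r : ℝ} (hr0 : 0 < r) (hr1 : r < 1) :
    ‖coefC σ a k‖ ≤ circleConst σ r / (Real.sqrt 2 * π) * Real.Gamma ((k : ℝ) / 2) /
      (r * Real.sqrt (2 * π * (1 + (fKer (-r)).re))) ^ k := by
  set m : ℝ := 1 + (fKer (-r)).re with hm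
  have hm0 : 0 < m := lt_of_lt_of_le (by norm_num) (half_le_one_add_re_fKer_neg hr0)
  set c : ℝ := 4 * π * m with hc
  have hc0 : 0 < c := by positivity
  set M : ℝ := circleConst σ r * Real.sqrt 2 ^ k / (2 * π * r ^ k) with hM
  have hA := circleConst_pos (σ := σ) hr0.le hr1
  have hM0 : 0 ≤ M := by positivity
  -- the integral of the majorant
  have hbound : ∀ u : ℝ, ‖coefIntegrand σ a k u‖ ≤ M * (|u| ^ (k - 1) * Real.exp (-c * u ^ 2)) := by
    intro u
    have := norm_coefIntegrand_le σ a hk hr0 hr1 u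
    rw [hM, hc, hm]
    convert this using 3
  have hint : Integrable fun u : ℝ ↦ M * (|u| ^ (k - 1) * Real.exp (-c * u ^ 2)) :=
    (integrable_abs_pow_mul_exp (k - 1) hc0).const_mul M
  have h1 : ‖∫ u : ℝ, coefIntegrand σ a k u‖ ≤ M * (c ^ (-((k : ℝ) / 2)) * Real.Gamma ((k : ℝ) / 2)) := by
    calc ‖∫ u : ℝ, coefIntegrand σ a k u‖ ≤ ∫ u : ℝ, M * (|u| ^ (k - 1) * Real.exp (-c * u ^ 2)) :=
          norm_integral_le_of_norm_le hint (Eventually.of_forall hbound)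
      _ = M * (c ^ (-((k : ℝ) / 2)) * Real.Gamma ((k : ℝ) / 2)) := by
          rw [integral_const_mul, integral_abs_pow_mul_exp hk hc0]
  -- the norm of the constant
  rw [coefC, norm_mul, norm_mul, norm_pow, norm_neg, norm_one, one_pow, one_mul, norm_cConst]
  refine (mul_le_mul_of_nonneg_left h1 (Real.sqrt_nonneg _)).trans (le_of_eq ?_)
  -- algebra: `√2 · M · c^{−k/2} = A/(√2 π (r√(2πm))^k)`
  have hsqrt_c : Real.sqrt c = Real.sqrt 2 * Real.sqrt (2 * π * m) := by
    rw [hc, show 4 * π * m = 2 * (2 * π * m) by ring, Real.sqrt_mul (by norm_num : (0:ℝ) ≤ 2)]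
  have hck : c ^ (-((k : ℝ) / 2)) = ((Real.sqrt 2 * Real.sqrt (2 * π * m)) ^ k)⁻¹ := by
    rw [Real.rpow_neg hc0.le, show (k : ℝ) / 2 = (1 / 2 : ℝ) * k by ring, Real.rpow_mul hc0.le,
      Real.rpow_natCast, ← Real.sqrt_eq_rpow, hsqrt_c]
  have hs2 : Real.sqrt 2 ^ 2 = 2 := Real.sq_sqrt (by norm_num)
  have hs2' : Real.sqrt 2 ≠ 0 := by positivity
  have hsm : Real.sqrt (2 * π * m) ≠ 0 := (Real.sqrt_pos.2 (by positivity)).ne'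
  rw [hck, hM, mul_pow, mul_pow]
  field_simp
  rw [hs2]

/-! ## `σ ≤ 0`: the limit `r → 1` -/

/-- **Thm. 4.1 for `σ ≤ 0`**: `|C_k| ≤ (2^{−σ}/(√2π)) Γ(k/2) / ((3 − 2 log 2)π)^{k/2}` for `k ≥ 1` and every
real `a`. [cite: AriasDeReyna2011, Thm. 4.1, eqs. (4.2)–(4.3)] -/
theorem norm_coefC_le_of_nonpos {σ : ℝ} (hσ : σ ≤ 0) (a : ℝ) {k : ℕ} (hk : 1 ≤ k) :
    ‖coefC σ a k‖ ≤ (2 : ℝ) ^ (-σ) / (Real.sqrt 2 * π) * Real.Gamma ((k : ℝ) / 2) /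
      Real.sqrt ((3 - 2 * Real.log 2) * π) ^ k := by
  -- the explicit bound as a function of `r`
  set B : ℝ → ℝ := fun r ↦ (1 + r) ^ (-σ) / (Real.sqrt 2 * π) * Real.Gamma ((k : ℝ) / 2) /
    (r * Real.sqrt (2 * π * (1 + (-Real.log (1 + r) / r ^ 2 + 1 / r - 1 / 2)))) ^ k with hB
  have hBr : ∀ r : ℝ, 0 < r → r < 1 → ‖coefC σ a k‖ ≤ B r := by
    intro r hr0 hr1
    have h := norm_coefC_le_of_radius σ a hk hr0 hr1
    have hcc : circleConst σ r = (1 + r) ^ (-σ) := by simp [circleConst, not_lt.2 hσ]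
    rw [hcc, fKer_neg_real hr0, Complex.ofReal_re] at h
    exact h
  have hB1 : B 1 = (2 : ℝ) ^ (-σ) / (Real.sqrt 2 * π) * Real.Gamma ((k : ℝ) / 2) /
      Real.sqrt ((3 - 2 * Real.log 2) * π) ^ k := by
    simp only [hB]
    norm_num
    congr 2
    ring_nf
  -- positivity of the inner expression on `(0, ∞)`
  have hm : ∀ r : ℝ, 0 < r → 0 < 1 + (-Real.log (1 + r) / r ^ 2 + 1 / r - 1 / 2) := by
    intro r hr0
    have := half_le_one_add_re_fKer_neg hr0
    rw [fKer_neg_real hr0, Complex.ofReal_re] at this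
    linarith
  -- continuity of `B` at `1`
  have hcont : ContinuousAt B 1 := by
    have hU : Ioi (0:ℝ) ∈ 𝓝 (1:ℝ) := Ioi_mem_nhds one_pos
    refine ContinuousOn.continuousAt ?_ hU
    simp only [hB]
    refine ContinuousOn.div ?_ ?_ fun r hr ↦ ?_
    · refine ContinuousOn.mul (ContinuousOn.div_const ?_ _) continuousOn_const
      exact ContinuousOn.rpow_const (by fun_prop) fun r hr ↦ Or.inl (by simp only [mem_Ioi] at hr; linarith)
    · refine ContinuousOn.pow (ContinuousOn.mul continuousOn_id ?_) _
      refine Real.continuous_sqrt.comp_continuousOn (ContinuousOn.mul continuousOn_const ?_)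
      refine continuousOn_const.add ((ContinuousOn.sub (ContinuousOn.add ?_ ?_) continuousOn_const))
      · refine ContinuousOn.div (ContinuousOn.neg (ContinuousOn.log (by fun_prop) fun r hr ↦ ?_)) (by fun_prop)
          fun r hr ↦ ?_
        · simp only [mem_Ioi] at hr; linarith
        · simp only [mem_Ioi] at hr; positivity
      · exact ContinuousOn.div continuousOn_const continuousOn_id fun r hr ↦ (ne_of_gt hr)
    · simp only [mem_Ioi] at hr
      exact pow_ne_zero _ (mul_ne_zero hr.ne' (Real.sqrt_pos.2 (mul_pos (by positivity) (hm r hr))).ne')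
  -- pass to the limit `r → 1⁻`
  rw [← hB1]
  refine ge_of_tendsto (hcont.tendsto.mono_left nhdsWithin_le_nhds : Tendsto B (𝓝[<] 1) (𝓝 (B 1))) ?_
  filter_upwards [Ioo_mem_nhdsLT (by norm_num : (0:ℝ) < 1)] with r hr using hBr r hr.1 hr.2

/-! ## `σ > 0`: the radius `r = 8/9` -/

/-- `log(17/9) ≤ 0.6401` (from seven terms of the series of `log(1 − 8/17)`). [cite: AriasDeReyna2011, proof of Thm. 4.1 ("`r²(1 + V(re^{iθ})) ≥ 0.647961`")] -/
lemma log_seventeen_div_nine_le : Real.log (17 / 9) ≤ 0.6401 := by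
  have h := Real.abs_log_sub_add_sum_range_le (x := 8 / 17) (by norm_num) 7
  have hl : Real.log (17 / 9 : ℝ) = -Real.log (1 - 8 / 17) := by
    rw [show (1 : ℝ) - 8 / 17 = (17 / 9)⁻¹ by norm_num, Real.log_inv, neg_neg]
  rw [hl]
  have h2 := (abs_le.1 h).1
  simp only [Finset.sum_range_succ, Finset.sum_range_zero] at h2
  norm_num at h2 ⊢
  linarith

/-- The choice `r = 8/9` gives `b ≥ 2`: `(8/9) √(2π(1 + V(−8/9))) ≥ 2`.
[cite: AriasDeReyna2011, proof of Thm. 4.1] -/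
lemma two_le_radius_eight_ninths :
    (2 : ℝ) ≤ 8 / 9 * Real.sqrt (2 * π * (1 + (fKer (-(8 / 9 : ℝ))).re)) := by
  rw [fKer_neg_real (by norm_num : (0:ℝ) < 8 / 9), Complex.ofReal_re]
  have hlog := log_seventeen_div_nine_le
  have hpi := Real.pi_gt_d2
  have hm : 0.8147 ≤ 1 + (-Real.log (1 + 8 / 9) / (8 / 9) ^ 2 + 1 / (8 / 9) - 1 / 2) := by
    rw [neg_div]
    norm_num at hlog ⊢
    linarith
  have h4 : (4 : ℝ) ≤ (8 / 9) ^ 2 * (2 * π * (1 + (-Real.log (1 + 8 / 9) / (8 / 9) ^ 2 + 1 / (8 / 9) - 1 / 2))) := by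
    nlinarith [mul_nonneg (sub_nonneg.2 hpi.le) (sub_nonneg.2 hm)]
  have hpos : 0 ≤ 2 * π * (1 + (-Real.log (1 + 8 / 9) / (8 / 9) ^ 2 + 1 / (8 / 9) - 1 / 2)) := by nlinarith
  calc (2 : ℝ) = Real.sqrt 4 := by rw [show (4:ℝ) = 2 ^ 2 by norm_num, Real.sqrt_sq (by norm_num)]
    _ ≤ Real.sqrt ((8 / 9) ^ 2 * (2 * π * (1 + (-Real.log (1 + 8 / 9) / (8 / 9) ^ 2 + 1 / (8 / 9) - 1 / 2)))) :=
        Real.sqrt_le_sqrt h4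
    _ = 8 / 9 * Real.sqrt (2 * π * (1 + (-Real.log (1 + 8 / 9) / (8 / 9) ^ 2 + 1 / (8 / 9) - 1 / 2))) := by
        rw [Real.sqrt_mul (by norm_num), Real.sqrt_sq (by norm_num)]

/-- **Thm. 4.1 for `σ > 0`**: `|C_k| ≤ (9^σ/(√2π)) Γ(k/2)/2^k` for `k ≥ 1` and every real `a`.
[cite: AriasDeReyna2011, Thm. 4.1, eqs. (4.2)–(4.3)] -/
theorem norm_coefC_le_of_pos {σ : ℝ} (hσ : 0 < σ) (a : ℝ) {k : ℕ} (hk : 1 ≤ k) :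
    ‖coefC σ a k‖ ≤ (9 : ℝ) ^ σ / (Real.sqrt 2 * π) * Real.Gamma ((k : ℝ) / 2) / 2 ^ k := by
  have h := norm_coefC_le_of_radius σ a hk (by norm_num : (0:ℝ) < 8 / 9) (by norm_num)
  have hcc : circleConst σ (8 / 9) = (9 : ℝ) ^ σ := by
    simp only [circleConst, hσ, if_true]
    rw [show (1 : ℝ) - 8 / 9 = 9⁻¹ by norm_num, Real.inv_rpow (by norm_num), ← Real.rpow_neg (by norm_num), neg_neg]
  rw [hcc] at h
  refine h.trans ?_
  have hΓ : 0 < Real.Gamma ((k : ℝ) / 2) := Real.Gamma_pos_of_pos (by positivity)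
  have hnum : 0 ≤ (9 : ℝ) ^ σ / (Real.sqrt 2 * π) * Real.Gamma ((k : ℝ) / 2) := by positivity
  refine div_le_div_of_nonneg_left hnum (by positivity) ?_
  exact pow_le_pow_left₀ (by norm_num) two_le_radius_eight_ninths k

/-- **Arias de Reyna's Thm. 4.1 in the shape of the tree's constants** `ariasC`, `ariasB`
(`Literature/NumberTheory/LFunctions/RiemannSiegelLehmerBounds.lean`): for `k ≥ 1` and every real `a`,
`|C_k| ≤ c(σ) Γ(k/2)/b(σ)^k`. [cite: AriasDeReyna2011, Thm. 4.1, eqs. (4.1)–(4.3)] -/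
theorem norm_coefC_le (σ a : ℝ) {k : ℕ} (hk : 1 ≤ k) :
    ‖coefC σ a k‖ ≤ (if 0 < σ then (9 : ℝ) ^ σ / (Real.sqrt 2 * π) else (2 : ℝ) ^ (-σ) / (Real.sqrt 2 * π)) *
      Real.Gamma ((k : ℝ) / 2) / (if 0 < σ then 2 else Real.sqrt ((3 - 2 * Real.log 2) * π)) ^ k := by
  split_ifs with hσ
  · exact norm_coefC_le_of_pos hσ a hk
  · exact norm_coefC_le_of_nonpos (not_lt.1 hσ) a hk

end AriasDeReyna

end Literature.NumberTheory.LFunctions
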